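import Summits.HodgeConjecture.HodgeConjecture.Theorems.DworkReflectionQuotientsGIOfGriffiths
import Literature.AlgebraicGeometry.HodgeTheory.DworkSexticPencilHodgeLociOfGriffithsQP
import HarnessLib

/-!
# Route `DworkReflectionQuotients`: the crux `GenericInvariantHodgeClasses` and the rung leaf BY NAME with Griffiths' theorem in its
# QUASI-PROJECTIVE form `Griffiths1968_holomorphicHodgeSubbundlesQP` (the statement the cell's programme GRIFFITHS-HOLOMORPHY proves)

Route `route-HodgeConjecture-DworkReflectionQuotients` (cell `hodge-nonav`; FRONTIER rung F-H1 — never summit credit). Prover seat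
`hodge-nonav-20241-p1` (g19). SUPPORT FILE (`--supports stmt-HodgeConjecture-24129`; CONDITIONAL results, nothing here closes an item).
Twin of `DworkReflectionQuotientsGIOfGriffiths` (g12) with the named fact `Griffiths1968_holomorphicHodgeSubbundles` REPLACED by the
weaker-hypothesis statement `Griffiths1968_holomorphicHodgeSubbundlesQP` (`Literature/…/GriffithsHolomorphicHodgeSubbundlesQP`: the fact's
body with the extra binder `IsQuasiProjectiveOver 𝒳`, satisfied by the Dwork pencil — `DworkSexticPencilHodgeLociOfGriffithsQP`), which is
the target `griffiths1968_holomorphicHodgeSubbundlesQP_holds` of programme GRIFFITHS-HOLOMORPHY (prover-Bx g17, p3 g35 decision (ii)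
2026-08-29T03:34:35Z). When that theorem lands, the «Griffiths1968 general» input of this route's floor is DISCHARGED by one application.

* `genericInvariantHodgeClasses_of_griffiths1968QP_of_residues` — crux GI (stmt-HodgeConjecture-24129) BY NAME modulo
  {`Griffiths1968_holomorphicHodgeSubbundlesQP`, `DworkSextic.Voisin2003_dworkPencil_residues_infinitesimal`};
* `genericHodgeClassesFlat_of_isFano_of_KMM_of_griffiths1968QP_of_residues` — support `GenericHodgeClassesFlat` (stmt-HodgeConjecture-20243);
* `dworkSexticHodge_of_isFano_of_KMM_of_griffiths1968QP_of_residues` — the rung leaf `DworkSexticHodge` BY NAME modulo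
  {Bini–Garbagnati Prop. 3.20, Kollár–Miyaoka–Mori, Griffiths 1968 (QP form), Carlson–Griffiths residues along the pencil}.

Honest scope: conditional structure theorems; nothing here says HC, HC_CM or HC_AV is proved; rung F-H1 not moved.

## References

* [VoisinHodgeI2002] C. Voisin, Hodge Theory and Complex Algebraic Geometry I (2002), §10.2.1 Thm. 10.3.
* [VoisinHodgeII2003] C. Voisin, Hodge Theory and Complex Algebraic Geometry II (2003), §5.3.1 Lemma 5.13, Thm. 6.24 (proof).
* [BiniGarbagnati2012] G. Bini, A. Garbagnati, Quotients of the Dwork pencil, J. Geom. Phys. 75 (2014), Prop. 3.20.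
* [KollarMiyaokaMori1992] J. Kollár, Y. Miyaoka, S. Mori, Rational connectedness and boundedness of Fano manifolds, J. Differential
  Geom. 36 (1992), Thm. 0.1.
-/

-- mandated namespace `Summit.HodgeConjecture.HodgeConjecture.Theorems` trips `linter.dupNamespace` (off tree-wide)
set_option linter.dupNamespace false

namespace Summit.HodgeConjecture.HodgeConjecture.Theorems

open Literature.AlgebraicGeometry.HodgeTheory Literature.AlgebraicGeometry.Motives

/-- **Crux GI `GenericInvariantHodgeClasses` (stmt-HodgeConjecture-24129) BY NAME modulo Griffiths' theorem in QP form and the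
Carlson–Griffiths residues along the pencil.** CONDITIONAL; rung F-H1 not moved. [cite: VoisinHodgeI2002, §10.2.1 Thm. 10.3]
[cite: VoisinHodgeII2003, Thm. 6.13 and Thm. 6.24 (proof)] -/
theorem genericInvariantHodgeClasses_of_griffiths1968QP_of_residues
    (hG : Griffiths1968_holomorphicHodgeSubbundlesQP)
    (hres : DworkSextic.Voisin2003_dworkPencil_residues_infinitesimal) :
    Summit.HodgeConjecture.HodgeConjecture.Theses.DworkReflectionQuotients.GenericInvariantHodgeClasses :=
  genericInvariantHodgeClasses_of_facts
    (DworkSextic.Voisin2002_dworkPencil_hodgeFiltrationTwo_locus_dichotomy_of_griffiths1968QP hG)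
    (DworkSextic.Voisin2003_dworkPencil_invariantFlatSection_climb_of_residues hres)

/-- **The support `GenericHodgeClassesFlat` (stmt-HodgeConjecture-20243) BY NAME from {Bini–Garbagnati 3.20, Kollár–Miyaoka–Mori,
Griffiths 1968 (QP form), pencil residues}.** CONDITIONAL; rung F-H1 not moved. [cite: BiniGarbagnati2012, Prop. 3.20]
[cite: VoisinHodgeII2003, Thm. 6.24 (proof)] -/
theorem genericHodgeClassesFlat_of_isFano_of_KMM_of_griffiths1968QP_of_residues
    (hF : DworkSextic.BiniGarbagnati2012_reflectionQuotient_isFano)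
    (hK : KollarMiyaokaMori1992_fano_rationallyChainConnected)
    (hG : Griffiths1968_holomorphicHodgeSubbundlesQP)
    (hres : DworkSextic.Voisin2003_dworkPencil_residues_infinitesimal) :
    Summit.HodgeConjecture.HodgeConjecture.Theses.DworkReflectionQuotients.GenericHodgeClassesFlat :=
  genericHodgeClassesFlat_of_reflectionQuotientDescent_of_facts (reflectionQuotientDescent_of_isFano_of_KMM hF hK)
    (DworkSextic.Voisin2002_dworkPencil_hodgeFiltrationTwo_locus_dichotomy_of_griffiths1968QP hG)
    (DworkSextic.Voisin2003_dworkPencil_invariantFlatSection_climb_of_residues hres)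

/-- **The rung leaf `DworkSexticHodge` (HC for the very general Dwork sextic fourfold) BY NAME from {Bini–Garbagnati Prop. 3.20,
Kollár–Miyaoka–Mori, Griffiths 1968 (QP form), Carlson–Griffiths residues along the pencil}.** CONDITIONAL; FRONTIER rung F-H1, never
summit credit; nothing here says HC, HC_CM or HC_AV is proved. [cite: BiniGarbagnati2012, Prop. 3.20] [cite: KollarMiyaokaMori1992, Thm. 0.1]
[cite: VoisinHodgeI2002, §10.2.1 Thm. 10.3] [cite: VoisinHodgeII2003, Thm. 6.13 and Thm. 6.24 (proof)] -/
theorem dworkSexticHodge_of_isFano_of_KMM_of_griffiths1968QP_of_residues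
    (hF : DworkSextic.BiniGarbagnati2012_reflectionQuotient_isFano)
    (hK : KollarMiyaokaMori1992_fano_rationallyChainConnected)
    (hG : Griffiths1968_holomorphicHodgeSubbundlesQP)
    (hres : DworkSextic.Voisin2003_dworkPencil_residues_infinitesimal) :
    Summit.HodgeConjecture.HodgeConjecture.Theses.DworkPrymHodge.DworkSexticHodge :=
  dworkSexticHodge_of_reflectionQuotientDescent_of_facts (reflectionQuotientDescent_of_isFano_of_KMM hF hK)
    (DworkSextic.Voisin2002_dworkPencil_hodgeFiltrationTwo_locus_dichotomy_of_griffiths1968QP hG)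
    (DworkSextic.Voisin2003_dworkPencil_invariantFlatSection_climb_of_residues hres)

end Summit.HodgeConjecture.HodgeConjecture.Theorems
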